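import Literature.MathematicalPhysics.QuantumFieldTheory.Balaban1983to89.B9Eq371Composition

/-!
# `Balaban1983to89.B9Eq372Locality` — B9, p. 405: the LOCALITY CLAUSE of (3.72)/(3.73) — «It is a local, bounded operator … with
# the same norms |A|, |A′| determined by the set st(b) as in (3.69)» — for the operators `F_{1,k}(A)`, `V₁(A)` of (3.71) as typed in
# `B9Eq371Composition`: the bonds of `st(b)`, locality as congruence theorems, and (3.72)/(3.73) with the `st(b)`-norms; kernel-checked; v1

CITATION HEADER (lean-in-tree rule).  Audit cell `pub-balaban`, surge node-prover lineage pv27 (B9 pp. 390–392, 396–397, 404–405),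
unit `b2b-balaban-pv27-g18` (journal CLAIM l.56570, node B9-EQ372-LOCALITY; fourth node of the seat, after B9-EQ369-PRODUCT =
`B9Eq369Product` (p189850, v1.1 p190342), B9-EQ370-EXPANSION = `B9Eq370Expansion` (p190151, v1.1 p190343) and B9-EQ371-COMPOSITION =
`B9Eq371Composition` (p190660) — the single import).  Source: T. Bałaban, *Propagators for lattice gauge theories in a background
field*, Commun. Math. Phys. **99** (1985) 389–434 [Balaban1985BackgroundPropagators] (cell paper B9; journal page = PDF page + 388),
p. 405 [PDF 17] (the `F_{1,k}` sentence, (3.72), (3.73)) and p. 404 [PDF 16] (the definition of `st(b)` after (3.69)), with (3.3)/(3.4)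
p. 390–391, (3.37) p. 396 [PDF 8] and (3.39) p. 397 [PDF 9], quoted from the page renders `b2b-balaban-ref1/pages/1985-cmp99-background-
propagators/…-p016-x2.png`, `…-p017-x2.png` READ AS IMAGES by this seat (2026-08-19).  The full verbatim transcription of (3.70)–(3.74)
is in the header of `B9Eq370Expansion`, that of (3.71) with both first-order brackets in `B9Eq371Composition`, the (3.69)/`st(b)` passage
in `B9Eq369Small` — all imported BY NAME, transitively.

HONEST FRAMING (cell charter, verbatim in substance).  The cell audits Bałaban's papers; discharging its end statements would
make Bałaban's ultraviolet stability theorem unconditional inside this package — a constructive-QFT statement; it is NOT the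
continuum limit and NOT the Clay problem.  THIS FILE DISCHARGES NOTHING of the series: it is finite bookkeeping — which lattice
letters enter the closed forms of `B9Eq371Composition`, a truncation argument, and one re-run of a seven-term triangle inequality —
on the lineage's lattice carrier (`B9Eq39Adjoint`: `R W X = WXW⁻¹`, `covD`, `covDstar`, `curl`, `prodCfg U η A = (b ↦ e^{iηA(b)}·U(b))`),
consuming BY NAME `B9Eq371Composition` (`tBracket`, `sBracket`, `fRem`, `F₁op`, `V₁op`, `tBracket_eq_sBracket`, `covDstar_curl_prodCfg`,
`norm_fRem_le`, `norm_R_le_sq`, `norm_ad_le_of_le`), `B9Eq370Expansion` (`norm_Iη_smul`, `conjRem`), `B9Eq369Small.Through` (the print's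
`st(b)`) and the commutator `ad` of `Beta.BackgroundVertices`.  Value = kernel certificate of the print's word «local» for `F_{1,k}(A)`
and `V₁(A)`: at the bond `b = ⟨x, x+e_μ⟩` both operators see the exponent field `A` and the argument `A′` ONLY through their values on
the boundary bonds of the `2(d−1)` plaquettes through `b` (= the print's `st(b)`, `mem_stBonds_iff`), the summands of the degenerate
direction `ν = μ` vanishing identically; and that (3.72)/(3.73) hold with the SAME explicit constants as in `B9Eq371Composition` when
the sup norms are taken over `st(b)` only — with the factor `d` improved to `d − 1`.  NOT summit progress.

ABSOLUTE RULE.  No internally-minted statement enters as a cited fact.  Every declaration below is PROVED (tags `[folklore]`);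
the `[cite: …]` tags document WHICH PRINTED CLAUSE a definition or a proved statement transcribes — the proofs are ours, the
print is not used as a hypothesis anywhere.  The regularity input (3.37) enters the three `_st_printed` corollaries as HYPOTHESES on
the letters of `st(b)` (`‖A(b′)‖ ≤ a ≤ α₁(L^jη)⁻¹`, `‖(D¹A)‖ ≤ g ≤ η·α₁(L^jη)⁻²` on `stBonds(b)`/`stGrads(b)`) with `α₁`, `L ≥ 1`,
`η > 0`, `j` as binders.

LETTERS AND NORMALISATION (as `B9Eq371Composition`): `A` = exponent field of `U′ = e^{iηA}`, `A′` = the argument; `D¹ = covD = ηD`,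
`D¹* = covDstar = ηD*`; every object is `η²` × the printed one.  A BOND is a pair `(κ, z)` = `⟨z, z + e_κ⟩` (direction, initial
site); `x + e_ν = T ν x`, `x − e_ν = (T ν).symm x`.  The boundary of the plaquette `p_{κν}(y)` is `∂p = {(κ, y), (ν, y+e_κ), (κ, y+e_ν),
(ν, y)}` — the four letters of `(D_U A)(p)` in (3.4) («(D_^η A)(p) = … for p = <x, x + ηe_μ, x + ηe_μ + ηe_ν, x + ηe_ν, x>», p. 391).

WHAT IS IN PRINT («…» verbatim from the renders).  p. 405 [PDF 17], after (3.71): «The operator F_{1,k} is defined similarly to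
F′_{1,k} by taking the remainder of the expansion R(U′) = exp ηiad_A = 1 + ηiad_A + ⋯ in the expressions above. It is a local,
bounded operator satisfying the bound |(F_{1,k}(A)A′)_μ(x)| ≤ O(1)|A|²|A′| ≤ O(1)α₁²(L^jη)⁻²|A′|, b ∈ Ω_j (3.72) with the same norms
|A|, |A′| determined by the set st(b) as in (3.69). The operator V₁ satisfies |(V₁(A)A′)(b)| ≤ O(1)(|A||∇A′| + |∇A||A′| + |A|²|A′|) ≤
O(1)α₁((L^jη)⁻¹|∇A′| + (L^jη)⁻²|A′|), b ∈ Ω_j, (3.73) with the same conditions on norms as above. The derivatives are, of course,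
the covariant derivatives defined by U. The constant O(1) is an absolute constant depending on d only.»  p. 404 [PDF 16], after
(3.69): «the supremum on the right-hand side is taken over bonds belonging to one of the plaquettes containing the bond b (i.e. we
have max_{b′:b′⊂∂p,p∈st(b)}|A′(b′)|, where st(b) = {plaquettes p : b ⊂ ∂p and orientation of ∂p agrees with that of b}).»  (3.39),
p. 397: «|A| = max_μ sup_x |A_μ(x)|, |∇A| = max_{μ,ν} sup_x |(D_μA_ν)(x)|»; (3.37), p. 396: «|A′| < α₁(L^jη)⁻¹, |∇^η_U A′| < α₁(L^jη)⁻²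
on Ω_j».  READING (as fixed in `B9Eq371Composition` by the last equality of (3.71)): `V₁(A)A′ = Σ_ν[seven-term bracket]_ν +
F_{1,k}(A)A′`; «local» and «norms … determined by the set st(b)» are read as: the value at `b` depends on `A`, `A′` only through
`A(b′)`, `A′(b′)`, `b′ ⊂ ∂p`, `p ∈ st(b)`, and the bounds hold with `|A|`, `|A′|`, `|∇A|`, `|∇A′|` replaced by maxima over those `b′`
(for `∇`: over the forward differences `(D_κA_τ)(z)` whose two letters `(τ, z+e_κ)`, `(τ, z)` lie there).  The print's `st(b)` keeps
the orientation of `p`; as a SET OF BONDS `∂p` is orientation-free (`pBonds_comm`), and the positively oriented plaquettes through `b`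
are exactly `B9Eq369Small.Through T μ x` (typed for (3.69)): `mem_stBonds_iff`.

WHAT THIS FILE PROVES.  MODEL (as in the lineage leaves): `𝔸` a complete normed ℂ-algebra; sites `S`, directions `ι` (`Fintype` where
`Σ_ν` occurs, `LinearOrder` only where `Through` is mentioned, `Nontrivial` = `d ≥ 2` in the three `_st_printed` corollaries), shifts
`T ν : S ≃ S` (NO commutation assumed), background `U : ι → S → 𝔸ˣ` (ARBITRARY units), `A`, `A′ : ι → S → 𝔸`; norms = the `NormedRing` norm.
* §1 SETS: `pBonds T κ ν y` (= `∂p_{κν}(y)`, `pBonds_comm`); `dirBonds T ν μ x = ∂p_{νμ}(x) ∪ ∂p_{νμ}(x − e_ν)` (the two plaquettes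
  through `b = (μ, x)` in the `(ν, μ)`-plane); **`stBonds T μ x = ⋃_{ν ≠ μ} dirBonds T ν μ x`** — THE BONDS OF `st(b)`; `dirGrads`/`stGrads`
  (the index triples `(κ, τ, z)` of the forward differences entering, `letters_of_mem_dirGrads`/`letters_of_mem_stGrads`: both letters
  in `dirBonds`/`stBonds`); `base_mem_dirBonds` (`b ∈ ∂p`); **`mem_stBonds_iff`**: `q ∈ stBonds T μ x ↔ ∃ κ ν y, Through T μ x κ ν y ∧
  q ∈ pBonds T κ ν y`; `agree_on_stBonds_of_through` (from the plaquette-wise agreement shape of `B9Eq369Small.deltaPrimeOp_congr_local`).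
* §2 THE DEGENERATE DIRECTION: **`tBracket_self`**, **`sBracket_self`**, **`fRem_self`** — the `ν = μ` summands of (3.71) are ZERO
  identically (`(DA′)_{μμ} = 0`, `x − e_μ + e_μ = x`; for `fRem` through the identity `covDstar_curl_prodCfg`); hence `F₁op_eq_sum_erase`,
  `sum_sBracket_eq_sum_erase`: `F₁(A)A′`, `Σ_ν sBracket_ν` at `b` are sums over `ν ≠ μ` — the `2(d−1)` plaquettes of `st(b)`.
* §3 LOCALITY («It is a local … operator»): **`tBracket_congr`**, **`sBracket_congr`**, **`fRem_congr`** — if `A, B` agree on `dirBonds T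
  ν μ x` and `A′, B′` agree there, the direction-`ν` summands agree (ten letters: `A` at `(ν, x−e_ν), (μ, x−e_ν), (ν, x), (μ, x)`; `A′` at
  `(μ, x), (μ, x−e_ν), (ν, x−e_ν+e_μ), (ν, x−e_ν), (μ, x+e_ν), (ν, x+e_μ)` — all on `∂p_{νμ}(x) ∪ ∂p_{νμ}(x−e_ν)`); **`F₁op_congr_st`**,
  `sum_sBracket_congr_st`, **`V₁op_congr_st`** — agreement on `stBonds(b)` ⟹ the same `(F₁(A)A′)(b)`, `(V₁(A)A′)(b)`; and the same in
  the plaquette-wise `Through` shape: **`F₁op_congr_local`**, **`V₁op_congr_local`**.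
* §4 THE BOUNDS WITH THE `st(b)`-NORMS («with the same norms |A|, |A′| determined by the set st(b)», «with the same conditions on
  norms as above»; transport size `‖U(b)‖, ‖U(b)⁻¹‖ ≤ ρ` kept uniform as in (3.35); `s = ηρ²a`): `trunc` (truncation of a field to a
  bond set), `norm_trunc_le`; **`norm_fRem_le_local`** (= `norm_fRem_le` with `‖A‖ ≤ a`, `‖A′‖ ≤ a′` on `dirBonds` only — locality +
  truncation); **`norm_F₁op_le_st`** — (3.72), first inequality: `‖(F₁(A)A′)(b)‖ ≤ (d−1)·8ρ⁴s²e^{2s}(3 + 2s + s²e^{2s})·a′` with `a`, `a′`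
  the maxima over `stBonds(b)`; **`norm_sBracket_le_local`** (the seven-term estimate of `B9Eq371Composition.norm_sBracket_le` re-run
  with its thirteen letter bounds on `dirBonds`/`dirGrads` only: `≤ η((8ρ² + 4)ag′ + 2ρ²(1 + ρ²)ga′)`), `norm_sum_sBracket_le_st`
  (`≤ (d−1)·η(…)`), **`norm_V₁op_le_st`** — (3.73), first inequality, all three printed terms: `‖(V₁(A)A′)(b)‖ ≤ (d−1)·[η((8ρ² + 4)ag′ +
  2ρ²(1 + ρ²)ga′) + 8ρ⁴s²e^{2s}(3 + 2s + s²e^{2s})a′]` with every bound taken on `stBonds(b)`/`stGrads(b)`; at the PRINTED SCALE (`ρ = 1`,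
  (3.37) on `st(b)` only, `d ≥ 2`): **`norm_F₁op_le_st_printed`** `≤ (d−1)·8e^{2α₁}(3 + 2α₁ + α₁²e^{2α₁})·α₁²·L^{−2j}·a′` — (3.72), second
  inequality; `norm_sum_sBracket_le_st_printed` `≤ 4(d−1)α₁(3L^{−j}g′ + L^{−2j}a′)`; **`norm_V₁op_le_st_printed`** `≤ (d−1)·α₁·[12L^{−j}g′ +
  (4 + 8α₁e^{2α₁}(3 + 2α₁ + α₁²e^{2α₁}))L^{−2j}a′]` — (3.73), second inequality (×`η²`; «depending on d only» through `d − 1` once `α₁ ≤ 1`).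
* §5 SANITY (`example`s): a field vanishing on `st(b)` gives `(F₁(A)A′)(b) = 0`; in one dimension `stBonds = ∅` and `V₁(A)A′ = 0`.

RELATED IN THE TREE, NOT DUPLICATED (searched 2026-08-19: MODULE-MAP rows B9/B12/Beta; `grep -rn "st(b)\|stBonds\|pBonds\|(3.72)"
Balaban1983to89/`): `B9Eq369Small` types `st(b)` as the predicate `Through` and proves the locality of `Δ′` (`deltaPrimeOp_congr_local`,
(3.69)) — used BY NAME for the dictionary `mem_stBonds_iff`, not restated; `B9Eq369Product.norm_deltaPrimeOp_le_local` is (3.69) with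
`st(b)`-sups for `Δ′`, a different operator; `B9Eq371Composition` proves (3.71)–(3.73) with UNIFORM sups and lists the locality clause as
NOT PROVED — this file is exactly that clause; `B7BlockGeometry.qppBonds`/`B13CorridorSeparation.depSet` are block-level dependence sets
of B7/B13, unrelated to `st(b)`.  Nothing in the tree types the bonds of `st(b)` as a set or proves locality / `st(b)`-norm bounds for
`F_{1,k}`, `V₁`.

NOT PROVED HERE, NOT CLAIMED: the domain geometry `b ∈ Ω_j` and the scale map `j(b)` (the scale-`j` constants are binders; (3.37) is a
hypothesis on the letters of `st(b)`); «bounded operator» as an operator-norm statement on a space of configurations (typed pointwise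
at each `b`, which is the content used downstream); the identification of `(S, T, ι)` with `T_η` beyond the displayed formulas (no
commutation of shifts is used: on `T_η` the seven bonds of `dirBonds T ν μ x` are seven distinct lattice bonds, here they are just the
listed pairs); (3.75)/(3.76) (`DRD*`, `V₂`, `F_{2,k}`, `P₁`) and after; any statement in the normalised Hilbert–Schmidt norm of p. 392
(cell DIVERGENCE D-1; unitary `G`-valued background = `ρ = 1`).  Records: GAPS C-pv27-74, DIVERGENCE D-pv27.10 (modelling divergences
only: bonds as (direction, site) pairs, `st(b)` as a bond set without orientation, transport size `ρ`, `d ≥ 2` in the printed-scale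
corollaries; NO print slip in the passage).  NOT summit progress.
-/

noncomputable section

namespace Literature.MathematicalPhysics.QuantumFieldTheory.Balaban1983to89.B9Eq372Locality

open NormedSpace Complex
open Literature.MathematicalPhysics.QuantumFieldTheory.Balaban1983to89
open Literature.MathematicalPhysics.QuantumFieldTheory.Balaban1983to89.Beta.TransportVertices
open Literature.MathematicalPhysics.QuantumFieldTheory.Balaban1983to89.Beta.BackgroundVertices
  (ad ad_apply norm_ad_le ad_add_left ad_add_right ad_sub_left ad_sub_right ad_neg_left ad_smul_left)
open Literature.MathematicalPhysics.QuantumFieldTheory.Balaban1983to89.B9Eq37Insertion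
open Literature.MathematicalPhysics.QuantumFieldTheory.Balaban1983to89.B9Eq39Adjoint
open Literature.MathematicalPhysics.QuantumFieldTheory.Balaban1983to89.B9Eq369Small (Through)
open Literature.MathematicalPhysics.QuantumFieldTheory.Balaban1983to89.B9Eq369Product
open Literature.MathematicalPhysics.QuantumFieldTheory.Balaban1983to89.B9Eq370Expansion
open Literature.MathematicalPhysics.QuantumFieldTheory.Balaban1983to89.B9Eq371Composition

/-! ## §1  The bonds of `st(b)`: boundary bonds of the plaquettes through `b = ⟨x, x + e_μ⟩` -/

section Sets

variable {S : Type*} {ι : Type*} (T : ι → Equiv.Perm S)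

/-- The four boundary bonds `b′ ⊂ ∂p` of the plaquette `p = p_{κν}(y)` as (direction, initial site) pairs:
`⟨y, y+e_κ⟩ = (κ, y)`, `⟨y+e_κ, y+e_κ+e_ν⟩ = (ν, T κ y)`, `⟨y+e_ν, y+e_ν+e_κ⟩ = (κ, T ν y)`, `⟨y, y+e_ν⟩ = (ν, y)` — the letters of
`(D_U A)(p)` in (3.4). [folklore] [cite: Balaban1985BackgroundPropagators, (3.4) p.391, p.404 after (3.69)] -/
def pBonds (κ ν : ι) (y : S) : Set (ι × S) := {(κ, y), (ν, T κ y), (κ, T ν y), (ν, y)}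

/-- `∂p` does not depend on the orientation of `p`. [folklore] -/
theorem pBonds_comm (κ ν : ι) (y : S) : pBonds T κ ν y = pBonds T ν κ y := by
  ext q
  simp only [pBonds, Set.mem_insert_iff, Set.mem_singleton_iff]
  tauto

/-- The letter set of DIRECTION `ν` at the bond `b = (μ, x)`: the boundary bonds of the two plaquettes `p_{νμ}(x)` and
`p_{νμ}(x − e_ν)` (`x − e_ν = (T ν)⁻¹ x`) — the plaquettes of `st(b)` lying in the `(ν, μ)`-plane. [folklore]
[cite: Balaban1985BackgroundPropagators, p.404 after (3.69)] -/
def dirBonds (ν μ : ι) (x : S) : Set (ι × S) := pBonds T ν μ x ∪ pBonds T ν μ ((T ν).symm x)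

/-- **THE BONDS OF `st(b)`**, `b = ⟨x, x + e_μ⟩`: «max_{b′:b′⊂∂p,p∈st(b)}|A′(b′)|, where st(b) = {plaquettes p : b ⊂ ∂p and orientation
of ∂p agrees with that of b}» — the union over the directions `ν ≠ μ` of `dirBonds T ν μ x` (the `2(d − 1)` plaquettes through `b`;
`= ⋃ {∂p : Through T μ x p}`, `mem_stBonds_iff`). [folklore] [cite: Balaban1985BackgroundPropagators, p.404 after (3.69), (3.72) p.405] -/
def stBonds (μ : ι) (x : S) : Set (ι × S) := ⋃ ν ∈ {ν : ι | ν ≠ μ}, dirBonds T ν μ x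

/-- The index set of the FORWARD COVARIANT DIFFERENCES `(D¹_κ A_τ)(z)` (triples `(κ, τ, z)`) entering the seven-term bracket of
direction `ν` at `b = (μ, x)` ((3.39): «|∇A| = max_{μ,ν} sup_x |(D_μA_ν)(x)|»); each has both its letters `(τ, z + e_κ)`, `(τ, z)` in
`dirBonds T ν μ x` (`letters_of_mem_dirGrads`). [folklore] [cite: Balaban1985BackgroundPropagators, (3.71) p.404–405, (3.39) p.397] -/
def dirGrads (ν μ : ι) (x : S) : Set (ι × ι × S) :=
  {(ν, ν, (T ν).symm x), (ν, μ, (T ν).symm x), (μ, ν, (T ν).symm x), (ν, μ, x), (μ, ν, x)}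

/-- … and their union over `ν ≠ μ`: the covariant differences «determined by the set st(b)». [folklore]
[cite: Balaban1985BackgroundPropagators, (3.73) p.405] -/
def stGrads (μ : ι) (x : S) : Set (ι × ι × S) := ⋃ ν ∈ {ν : ι | ν ≠ μ}, dirGrads T ν μ x

variable {T}

/-- The bonds of a plaquette of `st(b)` in the `(ν, μ)`-plane are bonds of `st(b)`. [folklore] -/
theorem mem_stBonds_of_mem {ν μ : ι} {x : S} (hν : ν ≠ μ) {q : ι × S} (h : q ∈ dirBonds T ν μ x) :
    q ∈ stBonds T μ x := Set.mem_biUnion (show ν ∈ {ν : ι | ν ≠ μ} from hν) h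

/-- … and the same for the index triples of the covariant differences. [folklore] -/
theorem mem_stGrads_of_mem {ν μ : ι} {x : S} (hν : ν ≠ μ) {q : ι × ι × S} (h : q ∈ dirGrads T ν μ x) :
    q ∈ stGrads T μ x := Set.mem_biUnion (show ν ∈ {ν : ι | ν ≠ μ} from hν) h

/-- `b` itself lies on every plaquette through it. [folklore] -/
theorem base_mem_dirBonds (ν μ : ι) (x : S) : (μ, x) ∈ dirBonds T ν μ x := by
  simp [dirBonds, pBonds]

/-- Every covariant difference indexed by `dirGrads` has both letters in `dirBonds` (`(D¹_κA_τ)(z) = R(U_κ(z))A_τ(z+e_κ) − A_τ(z)`).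
[folklore] [cite: Balaban1985BackgroundPropagators, (3.3) p.390] -/
theorem letters_of_mem_dirGrads {ν μ κ τ : ι} {x z : S} (h : (κ, τ, z) ∈ dirGrads T ν μ x) :
    (τ, T κ z) ∈ dirBonds T ν μ x ∧ (τ, z) ∈ dirBonds T ν μ x := by
  simp only [dirGrads, Set.mem_insert_iff, Set.mem_singleton_iff, Prod.mk.injEq] at h
  rcases h with ⟨rfl, rfl, rfl⟩ | ⟨rfl, rfl, rfl⟩ | ⟨rfl, rfl, rfl⟩ | ⟨rfl, rfl, rfl⟩ | ⟨rfl, rfl, rfl⟩ <;>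
    simp [dirBonds, pBonds]

/-- … hence every covariant difference indexed by `stGrads(b)` has both letters on `stBonds(b)`: the `|∇A|`, `|∇A′|` of (3.73) are
«determined by the set st(b)» too. [folklore] [cite: Balaban1985BackgroundPropagators, (3.73) p.405] -/
theorem letters_of_mem_stGrads {μ κ τ : ι} {x z : S} (h : (κ, τ, z) ∈ stGrads T μ x) :
    (τ, T κ z) ∈ stBonds T μ x ∧ (τ, z) ∈ stBonds T μ x := by
  obtain ⟨ν, hν, hq⟩ := Set.mem_iUnion₂.mp h
  have hν' : ν ≠ μ := hν
  obtain ⟨h₁, h₂⟩ := letters_of_mem_dirGrads hq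
  exact ⟨mem_stBonds_of_mem hν' h₁, mem_stBonds_of_mem hν' h₂⟩

/-- **`stBonds` IS THE SET OF BOUNDARY BONDS OF THE PLAQUETTES THROUGH `b`** (`B9Eq369Small.Through`, positively oriented plaquettes
`p_{κν}(y)`, `κ < ν`, with `b ⊂ ∂p`). [folklore] [cite: Balaban1985BackgroundPropagators, p.404 after (3.69)] -/
theorem mem_stBonds_iff [LinearOrder ι] {μ : ι} {x : S} {q : ι × S} :
    q ∈ stBonds T μ x ↔ ∃ κ ν y, Through T μ x κ ν y ∧ q ∈ pBonds T κ ν y := by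
  constructor
  · intro h
    obtain ⟨ν, hν, hq⟩ := Set.mem_iUnion₂.mp h
    have hν' : ν ≠ μ := hν
    rcases hq with hq | hq
    · rcases lt_or_gt_of_ne hν' with hlt | hgt
      · exact ⟨ν, μ, x, ⟨hlt, Or.inl ⟨rfl, Or.inl rfl⟩⟩, hq⟩
      · exact ⟨μ, ν, x, ⟨hgt, Or.inr ⟨rfl, Or.inl rfl⟩⟩, by rwa [pBonds_comm]⟩
    · rcases lt_or_gt_of_ne hν' with hlt | hgt
      · exact ⟨ν, μ, (T ν).symm x, ⟨hlt, Or.inl ⟨rfl, Or.inr rfl⟩⟩, hq⟩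
      · exact ⟨μ, ν, (T ν).symm x, ⟨hgt, Or.inr ⟨rfl, Or.inr rfl⟩⟩, by rwa [pBonds_comm]⟩
  · rintro ⟨κ, ν, y, ⟨hκν, h⟩, hq⟩
    rcases h with ⟨rfl, hy⟩ | ⟨rfl, hy⟩
    · refine mem_stBonds_of_mem (ne_of_lt hκν) ?_
      rcases hy with rfl | rfl
      · exact Or.inl hq
      · exact Or.inr hq
    · refine mem_stBonds_of_mem (ne_of_gt hκν) ?_
      rw [pBonds_comm] at hq
      rcases hy with rfl | rfl
      · exact Or.inl hq
      · exact Or.inr hq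

/-- From the plaquette-wise agreement shape of `B9Eq369Small.deltaPrimeOp_congr_local` to agreement on `stBonds`. [folklore] -/
theorem agree_on_stBonds_of_through [LinearOrder ι] {β : Type*} {A B : ι → S → β} {μ : ι} {x : S}
    (h : ∀ κ ν y, Through T μ x κ ν y →
      A κ y = B κ y ∧ A ν (T κ y) = B ν (T κ y) ∧ A κ (T ν y) = B κ (T ν y) ∧ A ν y = B ν y) :
    ∀ κ z, (κ, z) ∈ stBonds T μ x → A κ z = B κ z := by
  intro κ z hm
  obtain ⟨κ', ν', y, ht, hq⟩ := mem_stBonds_iff.mp hm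
  obtain ⟨h₁, h₂, h₃, h₄⟩ := h κ' ν' y ht
  simp only [pBonds, Set.mem_insert_iff, Set.mem_singleton_iff, Prod.mk.injEq] at hq
  rcases hq with ⟨rfl, rfl⟩ | ⟨rfl, rfl⟩ | ⟨rfl, rfl⟩ | ⟨rfl, rfl⟩
  · exact h₁
  · exact h₂
  · exact h₃
  · exact h₄

end Sets

/-! ## §2  The degenerate direction `ν = μ`: the summands of (3.71) vanish identically -/

section Degenerate

variable {𝔸 : Type*} [NormedRing 𝔸] [NormedAlgebra ℂ 𝔸] [CompleteSpace 𝔸] {S : Type*} {ι : Type*}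
variable (T : ι → Equiv.Perm S) (U : ι → S → 𝔸ˣ)

omit [CompleteSpace 𝔸] in
/-- The five-term bracket of direction `ν = μ` is zero: `(D A′)_{μμ} = 0` and the remaining letters cancel in pairs
(`x − e_μ + e_μ = x`). [folklore] [cite: Balaban1985BackgroundPropagators, (3.71) p.404] -/
theorem tBracket_self (η : ℝ) (A A' : ι → S → 𝔸) (μ : ι) (x : S) : tBracket T U η A A' μ μ x = 0 := by
  simp only [tBracket, curl_self, Equiv.apply_symm_apply, ad_apply, mul_zero, zero_mul, sub_self, R_zero]
  abel

omit [CompleteSpace 𝔸] in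
/-- … hence so is the seven-term bracket (`tBracket_eq_sBracket`). [folklore] [cite: Balaban1985BackgroundPropagators, (3.71) p.404–405] -/
theorem sBracket_self (η : ℝ) (A A' : ι → S → 𝔸) (μ : ι) (x : S) : sBracket T U η A A' μ μ x = 0 := by
  rw [← tBracket_eq_sBracket, tBracket_self]

/-- … and the higher-order summand of direction `μ` (from the identity `covDstar_curl_prodCfg` at `ν = μ`). [folklore]
[cite: Balaban1985BackgroundPropagators, (3.71) p.404, (3.72) p.405] -/
theorem fRem_self (η : ℝ) (A A' : ι → S → 𝔸) (μ : ι) (x : S) : fRem T U η A A' μ μ x = 0 := by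
  have h := covDstar_curl_prodCfg T U η A A' μ μ x
  simp only [covDstar, curl_self, R_zero, sub_self, tBracket_self, zero_add] at h
  exact h.symm

/-- So `F₁(A)A′` and `V₁(A)A′` at `b = (μ, x)` are sums over the directions `ν ≠ μ` only (the `2(d−1)` plaquettes of `st(b)`).
[folklore] [cite: Balaban1985BackgroundPropagators, (3.71) p.404–405] -/
theorem F₁op_eq_sum_erase [Fintype ι] [DecidableEq ι] (η : ℝ) (A A' : ι → S → 𝔸) (μ : ι) (x : S) :
    F₁op T U η A A' μ x = -∑ ν ∈ Finset.univ.erase μ, fRem T U η A A' ν μ x := by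
  rw [F₁op, ← Finset.add_sum_erase _ _ (Finset.mem_univ μ), fRem_self, zero_add]

omit [CompleteSpace 𝔸] in
/-- … and the same for the first-order part `Σ_ν sBracket_ν`. [folklore] [cite: Balaban1985BackgroundPropagators, (3.71) p.404–405] -/
theorem sum_sBracket_eq_sum_erase [Fintype ι] [DecidableEq ι] (η : ℝ) (A A' : ι → S → 𝔸) (μ : ι) (x : S) :
    ∑ ν, sBracket T U η A A' ν μ x = ∑ ν ∈ Finset.univ.erase μ, sBracket T U η A A' ν μ x := by
  rw [← Finset.add_sum_erase _ _ (Finset.mem_univ μ), sBracket_self, zero_add]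

end Degenerate

/-! ## §3  LOCALITY: the summands of direction `ν` see `A`, `A′` only on `dirBonds T ν μ x`; `F₁(A)A′`, `V₁(A)A′` at `b` only on `st(b)` -/

section Locality

variable {𝔸 : Type*} [NormedRing 𝔸] [NormedAlgebra ℂ 𝔸] [CompleteSpace 𝔸] {S : Type*} {ι : Type*}
variable (T : ι → Equiv.Perm S) (U : ι → S → 𝔸ˣ)

omit [CompleteSpace 𝔸] in
/-- The five-term bracket of direction `ν` at `b = (μ, x)` is determined by the letters of `A`, `A′` on `dirBonds T ν μ x`. [folklore]
[cite: Balaban1985BackgroundPropagators, (3.71) p.404] -/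
theorem tBracket_congr (η : ℝ) {A B A' B' : ι → S → 𝔸} {ν μ : ι} {x : S}
    (hA : ∀ κ z, (κ, z) ∈ dirBonds T ν μ x → A κ z = B κ z) (hA' : ∀ κ z, (κ, z) ∈ dirBonds T ν μ x → A' κ z = B' κ z) :
    tBracket T U η A A' ν μ x = tBracket T U η B B' ν μ x := by
  have h1 : A ν ((T ν).symm x) = B ν ((T ν).symm x) := hA _ _ (by simp [dirBonds, pBonds])
  have h2 : A μ ((T ν).symm x) = B μ ((T ν).symm x) := hA _ _ (by simp [dirBonds, pBonds])
  have h3 : A ν x = B ν x := hA _ _ (by simp [dirBonds, pBonds])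
  have h4 : A μ x = B μ x := hA _ _ (by simp [dirBonds, pBonds])
  have h5 : A' μ x = B' μ x := hA' _ _ (by simp [dirBonds, pBonds])
  have h6 : A' μ ((T ν).symm x) = B' μ ((T ν).symm x) := hA' _ _ (by simp [dirBonds, pBonds])
  have h7 : A' ν (T μ ((T ν).symm x)) = B' ν (T μ ((T ν).symm x)) := hA' _ _ (by simp [dirBonds, pBonds])
  have h8 : A' ν ((T ν).symm x) = B' ν ((T ν).symm x) := hA' _ _ (by simp [dirBonds, pBonds])
  have h9 : A' μ (T ν x) = B' μ (T ν x) := hA' _ _ (by simp [dirBonds, pBonds])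
  have h10 : A' ν (T μ x) = B' ν (T μ x) := hA' _ _ (by simp [dirBonds, pBonds])
  simp only [tBracket, curl, covD, Equiv.apply_symm_apply, h1, h2, h3, h4, h5, h6, h7, h8, h9, h10]

omit [CompleteSpace 𝔸] in
/-- **LOCALITY OF THE FIRST-ORDER PART**: the seven-term bracket of direction `ν` at `b` is determined by the letters on
`dirBonds T ν μ x` (its `D*`/`D`-letters included: `(D*_νA_ν)(x)`, `(D_μA′_ν)(x − e_ν)`, … have both letters there). [folklore]
[cite: Balaban1985BackgroundPropagators, (3.71) p.404–405, (3.73) p.405] -/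
theorem sBracket_congr (η : ℝ) {A B A' B' : ι → S → 𝔸} {ν μ : ι} {x : S}
    (hA : ∀ κ z, (κ, z) ∈ dirBonds T ν μ x → A κ z = B κ z) (hA' : ∀ κ z, (κ, z) ∈ dirBonds T ν μ x → A' κ z = B' κ z) :
    sBracket T U η A A' ν μ x = sBracket T U η B B' ν μ x := by
  rw [← tBracket_eq_sBracket, ← tBracket_eq_sBracket, tBracket_congr T U η hA hA']

/-- **LOCALITY OF THE HIGHER-ORDER PART** («It is a local … operator»): `fRem_ν(x)` is determined by the letters of `A`, `A′` on
`dirBonds T ν μ x`. [folklore] [cite: Balaban1985BackgroundPropagators, (3.72) p.405] -/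
theorem fRem_congr (η : ℝ) {A B A' B' : ι → S → 𝔸} {ν μ : ι} {x : S}
    (hA : ∀ κ z, (κ, z) ∈ dirBonds T ν μ x → A κ z = B κ z) (hA' : ∀ κ z, (κ, z) ∈ dirBonds T ν μ x → A' κ z = B' κ z) :
    fRem T U η A A' ν μ x = fRem T U η B B' ν μ x := by
  have h1 : A ν ((T ν).symm x) = B ν ((T ν).symm x) := hA _ _ (by simp [dirBonds, pBonds])
  have h2 : A μ ((T ν).symm x) = B μ ((T ν).symm x) := hA _ _ (by simp [dirBonds, pBonds])
  have h3 : A ν x = B ν x := hA _ _ (by simp [dirBonds, pBonds])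
  have h4 : A μ x = B μ x := hA _ _ (by simp [dirBonds, pBonds])
  have h5 : A' μ x = B' μ x := hA' _ _ (by simp [dirBonds, pBonds])
  have h6 : A' μ ((T ν).symm x) = B' μ ((T ν).symm x) := hA' _ _ (by simp [dirBonds, pBonds])
  have h7 : A' ν (T μ ((T ν).symm x)) = B' ν (T μ ((T ν).symm x)) := hA' _ _ (by simp [dirBonds, pBonds])
  have h8 : A' ν ((T ν).symm x) = B' ν ((T ν).symm x) := hA' _ _ (by simp [dirBonds, pBonds])
  have h9 : A' μ (T ν x) = B' μ (T ν x) := hA' _ _ (by simp [dirBonds, pBonds])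
  have h10 : A' ν (T μ x) = B' ν (T μ x) := hA' _ _ (by simp [dirBonds, pBonds])
  simp only [fRem, curlE₁, curlE₂, curl, covD, covDstar, prodCfg, fluct, Equiv.apply_symm_apply,
    h1, h2, h3, h4, h5, h6, h7, h8, h9, h10]

/-- **`F_{1,k}(A)` IS LOCAL**: two exponent fields and two arguments agreeing on the bonds of `st(b)` give the same `(F₁(A)A′)(b)`.
[folklore] [cite: Balaban1985BackgroundPropagators, (3.72) p.405] -/
theorem F₁op_congr_st [Fintype ι] (η : ℝ) {A B A' B' : ι → S → 𝔸} {μ : ι} {x : S}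
    (hA : ∀ κ z, (κ, z) ∈ stBonds T μ x → A κ z = B κ z) (hA' : ∀ κ z, (κ, z) ∈ stBonds T μ x → A' κ z = B' κ z) :
    F₁op T U η A A' μ x = F₁op T U η B B' μ x := by
  unfold F₁op
  congr 1
  refine Finset.sum_congr rfl fun ν _ => ?_
  by_cases hν : ν = μ
  · subst hν; rw [fRem_self, fRem_self]
  · exact fRem_congr T U η (fun κ z h => hA κ z (mem_stBonds_of_mem hν h))
      (fun κ z h => hA' κ z (mem_stBonds_of_mem hν h))

omit [CompleteSpace 𝔸] in
/-- The first-order part `Σ_ν sBracket_ν` at `b` is determined by the letters on `st(b)`. [folklore]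
[cite: Balaban1985BackgroundPropagators, (3.73) p.405] -/
theorem sum_sBracket_congr_st [Fintype ι] (η : ℝ) {A B A' B' : ι → S → 𝔸} {μ : ι} {x : S}
    (hA : ∀ κ z, (κ, z) ∈ stBonds T μ x → A κ z = B κ z) (hA' : ∀ κ z, (κ, z) ∈ stBonds T μ x → A' κ z = B' κ z) :
    ∑ ν, sBracket T U η A A' ν μ x = ∑ ν, sBracket T U η B B' ν μ x := by
  refine Finset.sum_congr rfl fun ν _ => ?_
  by_cases hν : ν = μ
  · subst hν; rw [sBracket_self, sBracket_self]
  · exact sBracket_congr T U η (fun κ z h => hA κ z (mem_stBonds_of_mem hν h))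
      (fun κ z h => hA' κ z (mem_stBonds_of_mem hν h))

/-- **`V₁(A)` IS LOCAL**: `(V₁(A)A′)(b)` is determined by the letters of `A`, `A′` on the bonds of `st(b)`. [folklore]
[cite: Balaban1985BackgroundPropagators, (3.73) p.405] -/
theorem V₁op_congr_st [Fintype ι] (η : ℝ) {A B A' B' : ι → S → 𝔸} {μ : ι} {x : S}
    (hA : ∀ κ z, (κ, z) ∈ stBonds T μ x → A κ z = B κ z) (hA' : ∀ κ z, (κ, z) ∈ stBonds T μ x → A' κ z = B' κ z) :
    V₁op T U η A A' μ x = V₁op T U η B B' μ x := by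
  rw [V₁op, V₁op, sum_sBracket_congr_st T U η hA hA', F₁op_congr_st T U η hA hA']

/-- The same in the plaquette-wise shape of `B9Eq369Small.deltaPrimeOp_congr_local`: agreement on the boundary bonds of every
plaquette THROUGH `b` ⟹ the same `(F₁(A)A′)(b)`. [folklore] [cite: Balaban1985BackgroundPropagators, (3.72) p.405, p.404 after (3.69)] -/
theorem F₁op_congr_local [Fintype ι] [LinearOrder ι] (η : ℝ) {A B A' B' : ι → S → 𝔸} (μ : ι) (x : S)
    (hA : ∀ κ ν y, Through T μ x κ ν y →
      A κ y = B κ y ∧ A ν (T κ y) = B ν (T κ y) ∧ A κ (T ν y) = B κ (T ν y) ∧ A ν y = B ν y)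
    (hA' : ∀ κ ν y, Through T μ x κ ν y →
      A' κ y = B' κ y ∧ A' ν (T κ y) = B' ν (T κ y) ∧ A' κ (T ν y) = B' κ (T ν y) ∧ A' ν y = B' ν y) :
    F₁op T U η A A' μ x = F₁op T U η B B' μ x :=
  F₁op_congr_st T U η (agree_on_stBonds_of_through hA) (agree_on_stBonds_of_through hA')

/-- … and the same `(V₁(A)A′)(b)`. [folklore] [cite: Balaban1985BackgroundPropagators, (3.73) p.405, p.404 after (3.69)] -/
theorem V₁op_congr_local [Fintype ι] [LinearOrder ι] (η : ℝ) {A B A' B' : ι → S → 𝔸} (μ : ι) (x : S)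
    (hA : ∀ κ ν y, Through T μ x κ ν y →
      A κ y = B κ y ∧ A ν (T κ y) = B ν (T κ y) ∧ A κ (T ν y) = B κ (T ν y) ∧ A ν y = B ν y)
    (hA' : ∀ κ ν y, Through T μ x κ ν y →
      A' κ y = B' κ y ∧ A' ν (T κ y) = B' ν (T κ y) ∧ A' κ (T ν y) = B' κ (T ν y) ∧ A' ν y = B' ν y) :
    V₁op T U η A A' μ x = V₁op T U η B B' μ x :=
  V₁op_congr_st T U η (agree_on_stBonds_of_through hA) (agree_on_stBonds_of_through hA')

end Locality

/-! ## §4  (3.72)/(3.73) «with the same norms |A|, |A′| determined by the set st(b)» -/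

section Bounds

variable {𝔸 : Type*} [NormedRing 𝔸] [NormedAlgebra ℂ 𝔸] [CompleteSpace 𝔸] {S : Type*} {ι : Type*}
variable (T : ι → Equiv.Perm S) (U : ι → S → 𝔸ˣ)

/-- TRUNCATION of a bond field to a set of bonds (zero outside). [folklore] -/
def trunc (L : Set (ι × S)) (A : ι → S → 𝔸) : ι → S → 𝔸 := fun κ z => L.indicator (fun q : ι × S => A q.1 q.2) (κ, z)

omit [NormedAlgebra ℂ 𝔸] [CompleteSpace 𝔸] in
/-- On the set the truncated field is the field. [folklore] -/
theorem trunc_of_mem {L : Set (ι × S)} {A : ι → S → 𝔸} {κ : ι} {z : S} (h : (κ, z) ∈ L) : trunc L A κ z = A κ z :=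
  Set.indicator_of_mem h _

omit [NormedAlgebra ℂ 𝔸] [CompleteSpace 𝔸] in
/-- A field bounded by `a ≥ 0` on `L` truncates to a field bounded by `a` everywhere. [folklore] -/
theorem norm_trunc_le {L : Set (ι × S)} {A : ι → S → 𝔸} {a : ℝ} (ha : 0 ≤ a)
    (hA : ∀ κ z, (κ, z) ∈ L → ‖A κ z‖ ≤ a) (κ : ι) (z : S) : ‖trunc L A κ z‖ ≤ a := by
  by_cases h : (κ, z) ∈ L
  · rw [trunc_of_mem h]; exact hA κ z h
  · simp [trunc, h, ha]

/-- **(3.72) WITH THE `st(b)`-NORMS, ONE DIRECTION**: the bound `norm_fRem_le` with `‖A(b′)‖ ≤ a`, `‖A′(b′)‖ ≤ a′` assumed ONLY for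
`b′ ∈ dirBonds T ν μ x` (locality + truncation). [folklore] [cite: Balaban1985BackgroundPropagators, (3.72) p.405] -/
theorem norm_fRem_le_local {η ρ a a' : ℝ} (hη : 0 ≤ η) (hρ : 1 ≤ ρ)
    (hU : ∀ κ z, ‖(U κ z : 𝔸)‖ ≤ ρ) (hU' : ∀ κ z, ‖(((U κ z)⁻¹ : 𝔸ˣ) : 𝔸)‖ ≤ ρ)
    (A A' : ι → S → 𝔸) {ν μ : ι} {x : S}
    (hA : ∀ κ z, (κ, z) ∈ dirBonds T ν μ x → ‖A κ z‖ ≤ a) (hA' : ∀ κ z, (κ, z) ∈ dirBonds T ν μ x → ‖A' κ z‖ ≤ a') :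
    ‖fRem T U η A A' ν μ x‖
      ≤ 8 * ρ ^ 4 * (η * ρ ^ 2 * a) ^ 2 * Real.exp (2 * (η * ρ ^ 2 * a))
          * (3 + 2 * (η * ρ ^ 2 * a) + (η * ρ ^ 2 * a) ^ 2 * Real.exp (2 * (η * ρ ^ 2 * a))) * a' := by
  have ha : 0 ≤ a := (norm_nonneg _).trans (hA μ x (base_mem_dirBonds ν μ x))
  have ha' : 0 ≤ a' := (norm_nonneg _).trans (hA' μ x (base_mem_dirBonds ν μ x))
  rw [fRem_congr T U η (B := trunc (dirBonds T ν μ x) A) (B' := trunc (dirBonds T ν μ x) A')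
    (fun κ z h => (trunc_of_mem h).symm) (fun κ z h => (trunc_of_mem h).symm)]
  exact norm_fRem_le T U hη hρ hU hU' _ _ (norm_trunc_le ha hA) (norm_trunc_le ha' hA') ν μ x

/-- **(3.72), FIRST INEQUALITY, WITH THE `st(b)`-NORMS**: `‖(F₁(A)A′)(b)‖ ≤ (d − 1)·8ρ⁴s²e^{2s}(3 + 2s + s²e^{2s})·a′`, `s = ηρ²a`, where
`a`, `a′` bound `‖A(b′)‖`, `‖A′(b′)‖` for `b′ ∈ stBonds(b)` ONLY — «with the same norms |A|, |A′| determined by the set st(b)»; the factor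
`d − 1` counts the planes of the `2(d−1)` plaquettes through `b`. [folklore] [cite: Balaban1985BackgroundPropagators, (3.72) p.405] -/
theorem norm_F₁op_le_st [Fintype ι] {η ρ a a' : ℝ} (hη : 0 ≤ η) (hρ : 1 ≤ ρ)
    (hU : ∀ κ z, ‖(U κ z : 𝔸)‖ ≤ ρ) (hU' : ∀ κ z, ‖(((U κ z)⁻¹ : 𝔸ˣ) : 𝔸)‖ ≤ ρ)
    (A A' : ι → S → 𝔸) {μ : ι} {x : S}
    (hA : ∀ κ z, (κ, z) ∈ stBonds T μ x → ‖A κ z‖ ≤ a) (hA' : ∀ κ z, (κ, z) ∈ stBonds T μ x → ‖A' κ z‖ ≤ a') :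
    ‖F₁op T U η A A' μ x‖
      ≤ (Fintype.card ι - 1) * (8 * ρ ^ 4 * (η * ρ ^ 2 * a) ^ 2 * Real.exp (2 * (η * ρ ^ 2 * a))
          * (3 + 2 * (η * ρ ^ 2 * a) + (η * ρ ^ 2 * a) ^ 2 * Real.exp (2 * (η * ρ ^ 2 * a))) * a') := by
  classical
  rw [F₁op_eq_sum_erase, norm_neg]
  have hcard : ((Finset.univ.erase μ).card : ℝ) = Fintype.card ι - 1 := by
    rw [Finset.card_erase_of_mem (Finset.mem_univ μ), Finset.card_univ,
      Nat.cast_sub (Fintype.card_pos_iff.mpr ⟨μ⟩), Nat.cast_one]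
  calc _ ≤ ∑ ν ∈ Finset.univ.erase μ, ‖fRem T U η A A' ν μ x‖ := norm_sum_le _ _
    _ ≤ ∑ _ν ∈ Finset.univ.erase μ, 8 * ρ ^ 4 * (η * ρ ^ 2 * a) ^ 2 * Real.exp (2 * (η * ρ ^ 2 * a))
          * (3 + 2 * (η * ρ ^ 2 * a) + (η * ρ ^ 2 * a) ^ 2 * Real.exp (2 * (η * ρ ^ 2 * a))) * a' :=
        Finset.sum_le_sum fun ν hν =>
          norm_fRem_le_local T U hη hρ hU hU' A A'
            (fun κ z h => hA κ z (mem_stBonds_of_mem (Finset.ne_of_mem_erase hν) h))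
            (fun κ z h => hA' κ z (mem_stBonds_of_mem (Finset.ne_of_mem_erase hν) h))
    _ = _ := by rw [Finset.sum_const, nsmul_eq_mul, hcard]

omit [CompleteSpace 𝔸] in
/-- **(3.73), FIRST INEQUALITY, ONE DIRECTION, WITH THE `st(b)`-NORMS**: the seven-term estimate `norm_sBracket_le` re-run with its
thirteen letter bounds taken ONLY on `dirBonds T ν μ x` / `dirGrads T ν μ x` («with the same conditions on norms as above»):
`‖sBracket_ν(x)‖ ≤ η((8ρ² + 4)·a·g′ + 2ρ²(1 + ρ²)·g·a′)`. [folklore] [cite: Balaban1985BackgroundPropagators, (3.73) p.405, (3.39) p.397] -/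
theorem norm_sBracket_le_local {η ρ a a' g g' : ℝ} (hη : 0 ≤ η)
    (hU : ∀ κ z, ‖(U κ z : 𝔸)‖ ≤ ρ) (hU' : ∀ κ z, ‖(((U κ z)⁻¹ : 𝔸ˣ) : 𝔸)‖ ≤ ρ)
    (A A' : ι → S → 𝔸) {ν μ : ι} {x : S}
    (hA : ∀ κ z, (κ, z) ∈ dirBonds T ν μ x → ‖A κ z‖ ≤ a) (hA' : ∀ κ z, (κ, z) ∈ dirBonds T ν μ x → ‖A' κ z‖ ≤ a')
    (hdA : ∀ κ τ z, (κ, τ, z) ∈ dirGrads T ν μ x → ‖covD T U κ (A τ) z‖ ≤ g)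
    (hdA' : ∀ κ τ z, (κ, τ, z) ∈ dirGrads T ν μ x → ‖covD T U κ (A' τ) z‖ ≤ g') :
    ‖sBracket T U η A A' ν μ x‖ ≤ η * ((8 * ρ ^ 2 + 4) * a * g' + 2 * ρ ^ 2 * (1 + ρ ^ 2) * g * a') := by
  -- the thirteen letters
  have hAνy : ‖A ν ((T ν).symm x)‖ ≤ a := hA _ _ (by simp [dirBonds, pBonds])
  have hAμy : ‖A μ ((T ν).symm x)‖ ≤ a := hA _ _ (by simp [dirBonds, pBonds])
  have hAνx : ‖A ν x‖ ≤ a := hA _ _ (by simp [dirBonds, pBonds])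
  have hAμx : ‖A μ x‖ ≤ a := hA _ _ (by simp [dirBonds, pBonds])
  have hA'μx : ‖A' μ x‖ ≤ a' := hA' _ _ (by simp [dirBonds, pBonds])
  have hA'νy : ‖A' ν ((T ν).symm x)‖ ≤ a' := hA' _ _ (by simp [dirBonds, pBonds])
  have hdAννy : ‖covD T U ν (A ν) ((T ν).symm x)‖ ≤ g := hdA _ _ _ (by simp [dirGrads])
  have hdAνμy : ‖covD T U ν (A μ) ((T ν).symm x)‖ ≤ g := hdA _ _ _ (by simp [dirGrads])
  have hdA'νμy : ‖covD T U ν (A' μ) ((T ν).symm x)‖ ≤ g' := hdA' _ _ _ (by simp [dirGrads])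
  have hdA'μνy : ‖covD T U μ (A' ν) ((T ν).symm x)‖ ≤ g' := hdA' _ _ _ (by simp [dirGrads])
  have hdA'νμx : ‖covD T U ν (A' μ) x‖ ≤ g' := hdA' _ _ _ (by simp [dirGrads])
  have hdA'μνx : ‖covD T U μ (A' ν) x‖ ≤ g' := hdA' _ _ _ (by simp [dirGrads])
  have hdA'ννy : ‖covD T U ν (A' ν) ((T ν).symm x)‖ ≤ g' := hdA' _ _ _ (by simp [dirGrads])
  have ha : 0 ≤ a := (norm_nonneg _).trans hAνx
  have ha' : 0 ≤ a' := (norm_nonneg _).trans hA'μx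
  have hg : 0 ≤ g := (norm_nonneg _).trans hdAννy
  have hg' : 0 ≤ g' := (norm_nonneg _).trans hdA'ννy
  have hρ0 : 0 ≤ ρ := (norm_nonneg _).trans (hU ν x)
  have hRt : ∀ κ z (Z : 𝔸), ‖R (U κ z)⁻¹ Z‖ ≤ ρ ^ 2 * ‖Z‖ := fun κ z Z =>
    norm_R_le_sq _ (hU' κ z) (by rw [inv_inv]; exact hU κ z) Z
  have hb : ∀ {X : 𝔸}, ‖X‖ ≤ a → ‖((I * η : ℂ)) • X‖ ≤ η * a := fun hX => by
    rw [norm_Iη_smul hη]; exact mul_le_mul_of_nonneg_left hX hη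
  -- the `D*`-letters through the forward differences (`covDstar_eq_neg_R_covD`)
  have hdsA : ‖covDstar T U ν (A ν) x‖ ≤ ρ ^ 2 * g := by
    rw [covDstar_eq_neg_R_covD, norm_neg]
    exact (hRt ν _ _).trans (mul_le_mul_of_nonneg_left hdAννy (by positivity))
  have hdsAμ : ‖covDstar T U ν (A μ) x‖ ≤ ρ ^ 2 * g := by
    rw [covDstar_eq_neg_R_covD, norm_neg]
    exact (hRt ν _ _).trans (mul_le_mul_of_nonneg_left hdAνμy (by positivity))
  have hdsA' : ‖covDstar T U ν (A' ν) x‖ ≤ ρ ^ 2 * g' := by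
    rw [covDstar_eq_neg_R_covD, norm_neg]
    exact (hRt ν _ _).trans (mul_le_mul_of_nonneg_left hdA'ννy (by positivity))
  have hbd : ∀ {X : 𝔸}, ‖X‖ ≤ ρ ^ 2 * g → ‖((I * η : ℂ)) • X‖ ≤ η * (ρ ^ 2 * g) := fun hX => by
    rw [norm_Iη_smul hη]; exact mul_le_mul_of_nonneg_left hX hη
  have hcurl : ‖curl T U A' ν μ ((T ν).symm x)‖ ≤ 2 * g' := by
    unfold curl; exact (norm_sub_le _ _).trans (by linarith [hdA'νμy, hdA'μνy])
  -- the seven terms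
  have h1 : ‖R (U ν ((T ν).symm x))⁻¹
        (ad (((I * η : ℂ)) • A ν ((T ν).symm x)) (curl T U A' ν μ ((T ν).symm x)))‖ ≤ ρ ^ 2 * (2 * (η * a) * (2 * g')) :=
    (hRt ν _ _).trans (mul_le_mul_of_nonneg_left
      ((norm_ad_le_of_le (hb hAνy) _).trans (mul_le_mul_of_nonneg_left hcurl (by positivity))) (by positivity))
  have h2 : ‖ad (((I * η : ℂ)) • covDstar T U ν (A ν) x) (A' μ x)‖ ≤ 2 * (η * (ρ ^ 2 * g)) * a' :=
    (norm_ad_le_of_le (hbd hdsA) _).trans (mul_le_mul_of_nonneg_left hA'μx (by positivity))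
  have h3 : ‖R (U ν ((T ν).symm x))⁻¹
        (ad (((I * η : ℂ)) • A μ ((T ν).symm x)) (covD T U μ (A' ν) ((T ν).symm x)))‖ ≤ ρ ^ 2 * (2 * (η * a) * g') :=
    (hRt ν _ _).trans (mul_le_mul_of_nonneg_left
      ((norm_ad_le_of_le (hb hAμy) _).trans (mul_le_mul_of_nonneg_left hdA'μνy (by positivity))) (by positivity))
  have h4 : ‖ad (((I * η : ℂ)) • A ν x) (covD T U ν (A' μ) x)‖ ≤ 2 * (η * a) * g' :=
    (norm_ad_le_of_le (hb hAνx) _).trans (mul_le_mul_of_nonneg_left hdA'νμx (by positivity))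
  have h5 : ‖ad (((I * η : ℂ)) • A μ x) (covD T U μ (A' ν) x)‖ ≤ 2 * (η * a) * g' :=
    (norm_ad_le_of_le (hb hAμx) _).trans (mul_le_mul_of_nonneg_left hdA'μνx (by positivity))
  have h6 : ‖ad (((I * η : ℂ)) • covDstar T U ν (A μ) x) (R (U ν ((T ν).symm x))⁻¹ (A' ν ((T ν).symm x)))‖
      ≤ 2 * (η * (ρ ^ 2 * g)) * (ρ ^ 2 * a') :=
    (norm_ad_le_of_le (hbd hdsAμ) _).trans (mul_le_mul_of_nonneg_left
      ((hRt ν _ _).trans (mul_le_mul_of_nonneg_left hA'νy (by positivity))) (by positivity))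
  have h7 : ‖ad (((I * η : ℂ)) • A μ x) (covDstar T U ν (A' ν) x)‖ ≤ 2 * (η * a) * (ρ ^ 2 * g') :=
    (norm_ad_le_of_le (hb hAμx) _).trans (mul_le_mul_of_nonneg_left hdsA' (by positivity))
  unfold sBracket
  refine (norm_add_le_of_le (norm_add_le_of_le (norm_sub_le_of_le (norm_add_le_of_le (norm_add_le_of_le
    (norm_sub_le_of_le h1 h2) h3) h4) h5) h6) h7).trans (le_of_eq ?_)
  ring

omit [CompleteSpace 𝔸] in
/-- (3.73) FOR THE FIRST-ORDER PART WITH THE `st(b)`-NORMS: `‖Σ_ν sBracket_ν‖ ≤ (d − 1)·η((8ρ² + 4)ag′ + 2ρ²(1 + ρ²)ga′)` with the letter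
and covariant-difference bounds taken only on `stBonds(b)` / `stGrads(b)`. [folklore] [cite: Balaban1985BackgroundPropagators, (3.73) p.405] -/
theorem norm_sum_sBracket_le_st [Fintype ι] {η ρ a a' g g' : ℝ} (hη : 0 ≤ η)
    (hU : ∀ κ z, ‖(U κ z : 𝔸)‖ ≤ ρ) (hU' : ∀ κ z, ‖(((U κ z)⁻¹ : 𝔸ˣ) : 𝔸)‖ ≤ ρ)
    (A A' : ι → S → 𝔸) {μ : ι} {x : S}
    (hA : ∀ κ z, (κ, z) ∈ stBonds T μ x → ‖A κ z‖ ≤ a) (hA' : ∀ κ z, (κ, z) ∈ stBonds T μ x → ‖A' κ z‖ ≤ a')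
    (hdA : ∀ κ τ z, (κ, τ, z) ∈ stGrads T μ x → ‖covD T U κ (A τ) z‖ ≤ g)
    (hdA' : ∀ κ τ z, (κ, τ, z) ∈ stGrads T μ x → ‖covD T U κ (A' τ) z‖ ≤ g') :
    ‖∑ ν, sBracket T U η A A' ν μ x‖
      ≤ (Fintype.card ι - 1) * (η * ((8 * ρ ^ 2 + 4) * a * g' + 2 * ρ ^ 2 * (1 + ρ ^ 2) * g * a')) := by
  classical
  rw [sum_sBracket_eq_sum_erase]
  have hcard : ((Finset.univ.erase μ).card : ℝ) = Fintype.card ι - 1 := by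
    rw [Finset.card_erase_of_mem (Finset.mem_univ μ), Finset.card_univ,
      Nat.cast_sub (Fintype.card_pos_iff.mpr ⟨μ⟩), Nat.cast_one]
  calc _ ≤ ∑ ν ∈ Finset.univ.erase μ, ‖sBracket T U η A A' ν μ x‖ := norm_sum_le _ _
    _ ≤ ∑ _ν ∈ Finset.univ.erase μ, η * ((8 * ρ ^ 2 + 4) * a * g' + 2 * ρ ^ 2 * (1 + ρ ^ 2) * g * a') :=
        Finset.sum_le_sum fun ν hν =>
          norm_sBracket_le_local T U hη hU hU' A A'
            (fun κ z h => hA κ z (mem_stBonds_of_mem (Finset.ne_of_mem_erase hν) h))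
            (fun κ z h => hA' κ z (mem_stBonds_of_mem (Finset.ne_of_mem_erase hν) h))
            (fun κ τ z h => hdA κ τ z (mem_stGrads_of_mem (Finset.ne_of_mem_erase hν) h))
            (fun κ τ z h => hdA' κ τ z (mem_stGrads_of_mem (Finset.ne_of_mem_erase hν) h))
    _ = _ := by rw [Finset.sum_const, nsmul_eq_mul, hcard]

/-- **(3.73), FIRST INEQUALITY, WITH THE `st(b)`-NORMS** — «|(V₁(A)A′)(b)| ≤ O(1)(|A||∇A′| + |∇A||A′| + |A|²|A′|) … with the same
conditions on norms as above»: `‖(V₁(A)A′)(b)‖ ≤ (d − 1)·[η((8ρ² + 4)ag′ + 2ρ²(1 + ρ²)ga′) + 8ρ⁴s²e^{2s}(3 + 2s + s²e^{2s})a′]`, all letter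
bounds on `stBonds(b)` / `stGrads(b)` only. [folklore] [cite: Balaban1985BackgroundPropagators, (3.73) p.405] -/
theorem norm_V₁op_le_st [Fintype ι] {η ρ a a' g g' : ℝ} (hη : 0 ≤ η) (hρ : 1 ≤ ρ)
    (hU : ∀ κ z, ‖(U κ z : 𝔸)‖ ≤ ρ) (hU' : ∀ κ z, ‖(((U κ z)⁻¹ : 𝔸ˣ) : 𝔸)‖ ≤ ρ)
    (A A' : ι → S → 𝔸) {μ : ι} {x : S}
    (hA : ∀ κ z, (κ, z) ∈ stBonds T μ x → ‖A κ z‖ ≤ a) (hA' : ∀ κ z, (κ, z) ∈ stBonds T μ x → ‖A' κ z‖ ≤ a')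
    (hdA : ∀ κ τ z, (κ, τ, z) ∈ stGrads T μ x → ‖covD T U κ (A τ) z‖ ≤ g)
    (hdA' : ∀ κ τ z, (κ, τ, z) ∈ stGrads T μ x → ‖covD T U κ (A' τ) z‖ ≤ g') :
    ‖V₁op T U η A A' μ x‖
      ≤ (Fintype.card ι - 1) * (η * ((8 * ρ ^ 2 + 4) * a * g' + 2 * ρ ^ 2 * (1 + ρ ^ 2) * g * a')
          + 8 * ρ ^ 4 * (η * ρ ^ 2 * a) ^ 2 * Real.exp (2 * (η * ρ ^ 2 * a))
            * (3 + 2 * (η * ρ ^ 2 * a) + (η * ρ ^ 2 * a) ^ 2 * Real.exp (2 * (η * ρ ^ 2 * a))) * a') := by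
  unfold V₁op
  have h1 := norm_sum_sBracket_le_st T U hη hU hU' A A' hA hA' hdA hdA'
  have h2 := norm_F₁op_le_st T U hη hρ hU hU' A A' hA hA'
  exact (norm_add_le_of_le h1 h2).trans (le_of_eq (by ring))


/-! ### The printed scale: (3.37) on `st(b)` only (`ρ = 1`, `d ≥ 2`) -/

omit [CompleteSpace 𝔸] in
/-- `0 ≤ d − 1` as soon as there is a direction. [folklore] -/
theorem card_sub_one_nonneg [Fintype ι] (μ : ι) : (0 : ℝ) ≤ Fintype.card ι - 1 := by
  have h : 1 ≤ Fintype.card ι := Fintype.card_pos_iff.mpr ⟨μ⟩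
  have h' : (1 : ℝ) ≤ Fintype.card ι := by exact_mod_cast h
  linarith

/-- **(3.72), SECOND INEQUALITY, `st(b)`-NORMS, PRINTED SCALE** (`ρ = 1`; (3.37) assumed ONLY on the bonds of `st(b)`: `‖A(b′)‖ ≤ a ≤
α₁(L^jη)⁻¹`, `‖A′(b′)‖ ≤ a′` for `b′ ∈ stBonds(b)`; `L ≥ 1`, `η > 0`, `d ≥ 2`): `‖(F₁(A)A′)(b)‖ ≤ (d − 1)·8e^{2α₁}(3 + 2α₁ + α₁²e^{2α₁})·α₁²·
L^{−2j}·a′` — «≤ O(1)α₁²(L^jη)⁻²|A′|, b ∈ Ω_j (3.72) with the same norms |A|, |A′| determined by the set st(b)» (×`η²`). [folklore]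
[cite: Balaban1985BackgroundPropagators, (3.72) p.405, (3.37) p.396] -/
theorem norm_F₁op_le_st_printed [Fintype ι] [Nontrivial ι] {η L α₁ a a' : ℝ} {j : ℕ} (hη : 0 < η) (hL : 1 ≤ L)
    (hU : ∀ κ z, ‖(U κ z : 𝔸)‖ ≤ 1) (hU' : ∀ κ z, ‖(((U κ z)⁻¹ : 𝔸ˣ) : 𝔸)‖ ≤ 1)
    (A A' : ι → S → 𝔸) {μ : ι} {x : S}
    (hA : ∀ κ z, (κ, z) ∈ stBonds T μ x → ‖A κ z‖ ≤ a) (ha : a ≤ α₁ * (L ^ j * η)⁻¹)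
    (hA' : ∀ κ z, (κ, z) ∈ stBonds T μ x → ‖A' κ z‖ ≤ a') :
    ‖F₁op T U η A A' μ x‖
      ≤ (Fintype.card ι - 1) * (8 * Real.exp (2 * α₁) * (3 + 2 * α₁ + α₁ ^ 2 * Real.exp (2 * α₁))
          * α₁ ^ 2 * ((L ^ j)⁻¹) ^ 2 * a') := by
  obtain ⟨ν, hν⟩ := exists_ne μ
  have hbase : (μ, x) ∈ stBonds T μ x := mem_stBonds_of_mem hν (base_mem_dirBonds ν μ x)
  have h := norm_F₁op_le_st T U hη.le le_rfl hU hU' A A' hA hA'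
  have hLj : 1 ≤ L ^ j := one_le_pow₀ hL
  have hLj0 : 0 < L ^ j := lt_of_lt_of_le one_pos hLj
  have ha0 : 0 ≤ a := (norm_nonneg _).trans (hA μ x hbase)
  have ha'0 : 0 ≤ a' := (norm_nonneg _).trans (hA' μ x hbase)
  have hs : η * 1 ^ 2 * a ≤ α₁ * (L ^ j)⁻¹ := by
    calc η * 1 ^ 2 * a = η * a := by ring
      _ ≤ η * (α₁ * (L ^ j * η)⁻¹) := mul_le_mul_of_nonneg_left ha hη.le
      _ = α₁ * (L ^ j)⁻¹ := by field_simp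
  have hs0 : 0 ≤ η * 1 ^ 2 * a := by positivity
  have hα : 0 ≤ α₁ := by
    by_contra hc
    have h1 : α₁ * (L ^ j)⁻¹ < 0 := mul_neg_of_neg_of_pos (lt_of_not_ge hc) (inv_pos.mpr hLj0)
    linarith
  have hs1 : η * 1 ^ 2 * a ≤ α₁ := hs.trans (mul_le_of_le_one_right hα (inv_le_one_of_one_le₀ hLj))
  have hE : Real.exp (2 * (η * 1 ^ 2 * a)) ≤ Real.exp (2 * α₁) := Real.exp_le_exp.mpr (by linarith)
  have hsq : (η * 1 ^ 2 * a) ^ 2 ≤ α₁ ^ 2 * ((L ^ j)⁻¹) ^ 2 := by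
    rw [← mul_pow]; exact pow_le_pow_left₀ hs0 hs 2
  have hsq' : (η * 1 ^ 2 * a) ^ 2 ≤ α₁ ^ 2 := pow_le_pow_left₀ hs0 hs1 2
  have hP : 3 + 2 * (η * 1 ^ 2 * a) + (η * 1 ^ 2 * a) ^ 2 * Real.exp (2 * (η * 1 ^ 2 * a))
      ≤ 3 + 2 * α₁ + α₁ ^ 2 * Real.exp (2 * α₁) := by
    have := mul_le_mul hsq' hE (by positivity) (sq_nonneg α₁)
    linarith
  refine h.trans (mul_le_mul_of_nonneg_left ?_ (card_sub_one_nonneg μ))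
  calc 8 * (1 : ℝ) ^ 4 * (η * 1 ^ 2 * a) ^ 2 * Real.exp (2 * (η * 1 ^ 2 * a))
          * (3 + 2 * (η * 1 ^ 2 * a) + (η * 1 ^ 2 * a) ^ 2 * Real.exp (2 * (η * 1 ^ 2 * a))) * a'
      ≤ 8 * (1 : ℝ) ^ 4 * (α₁ ^ 2 * ((L ^ j)⁻¹) ^ 2) * Real.exp (2 * α₁)
          * (3 + 2 * α₁ + α₁ ^ 2 * Real.exp (2 * α₁)) * a' := by
        gcongr
    _ = _ := by ring

omit [CompleteSpace 𝔸] in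
/-- (3.73), SECOND INEQUALITY, FIRST-ORDER PART, `st(b)`-NORMS, PRINTED SCALE (`ρ = 1`; (3.37) on `st(b)` only: `a ≤ α₁(L^jη)⁻¹`,
`g ≤ η·α₁(L^jη)⁻²`; `d ≥ 2`): `‖Σ_ν sBracket_ν‖ ≤ 4(d − 1)·α₁·(3L^{−j}·g′ + L^{−2j}·a′)`. [folklore]
[cite: Balaban1985BackgroundPropagators, (3.73) p.405, (3.37) p.396] -/
theorem norm_sum_sBracket_le_st_printed [Fintype ι] [Nontrivial ι] {η L α₁ a a' g g' : ℝ} {j : ℕ} (hη : 0 < η) (hL : 1 ≤ L)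
    (hU : ∀ κ z, ‖(U κ z : 𝔸)‖ ≤ 1) (hU' : ∀ κ z, ‖(((U κ z)⁻¹ : 𝔸ˣ) : 𝔸)‖ ≤ 1)
    (A A' : ι → S → 𝔸) {μ : ι} {x : S}
    (hA : ∀ κ z, (κ, z) ∈ stBonds T μ x → ‖A κ z‖ ≤ a) (ha : a ≤ α₁ * (L ^ j * η)⁻¹)
    (hA' : ∀ κ z, (κ, z) ∈ stBonds T μ x → ‖A' κ z‖ ≤ a')
    (hdA : ∀ κ τ z, (κ, τ, z) ∈ stGrads T μ x → ‖covD T U κ (A τ) z‖ ≤ g) (hg : g ≤ η * (α₁ * ((L ^ j * η)⁻¹) ^ 2))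
    (hdA' : ∀ κ τ z, (κ, τ, z) ∈ stGrads T μ x → ‖covD T U κ (A' τ) z‖ ≤ g') :
    ‖∑ ν, sBracket T U η A A' ν μ x‖ ≤ (Fintype.card ι - 1) * (4 * α₁ * (3 * (L ^ j)⁻¹ * g' + ((L ^ j)⁻¹) ^ 2 * a')) := by
  obtain ⟨ν, hν⟩ := exists_ne μ
  have hbase : (μ, x) ∈ stBonds T μ x := mem_stBonds_of_mem hν (base_mem_dirBonds ν μ x)
  have hgrad : (ν, μ, x) ∈ stGrads T μ x := mem_stGrads_of_mem hν (by simp [dirGrads])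
  have h := norm_sum_sBracket_le_st T U hη.le hU hU' A A' hA hA' hdA hdA'
  have hLj : 1 ≤ L ^ j := one_le_pow₀ hL
  have hLj0 : 0 < L ^ j := lt_of_lt_of_le one_pos hLj
  have ha'0 : 0 ≤ a' := (norm_nonneg _).trans (hA' μ x hbase)
  have hg' : 0 ≤ g' := (norm_nonneg _).trans (hdA' ν μ x hgrad)
  have h1 : η * a * g' ≤ α₁ * (L ^ j)⁻¹ * g' := by
    have : η * a ≤ α₁ * (L ^ j)⁻¹ := by
      calc η * a ≤ η * (α₁ * (L ^ j * η)⁻¹) := mul_le_mul_of_nonneg_left ha hη.le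
        _ = α₁ * (L ^ j)⁻¹ := by field_simp
    exact mul_le_mul_of_nonneg_right this hg'
  have h2 : η * g * a' ≤ α₁ * ((L ^ j)⁻¹) ^ 2 * a' := by
    have : η * g ≤ α₁ * ((L ^ j)⁻¹) ^ 2 := by
      calc η * g ≤ η * (η * (α₁ * ((L ^ j * η)⁻¹) ^ 2)) := mul_le_mul_of_nonneg_left hg hη.le
        _ = α₁ * ((L ^ j)⁻¹) ^ 2 := by field_simp
    exact mul_le_mul_of_nonneg_right this ha'0
  refine h.trans (mul_le_mul_of_nonneg_left ?_ (card_sub_one_nonneg μ))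
  nlinarith [h1, h2]

/-- **(3.73), SECOND INEQUALITY, `st(b)`-NORMS, PRINTED SCALE** — «≤ O(1)α₁((L^jη)⁻¹|∇A′| + (L^jη)⁻²|A′|), b ∈ Ω_j, (3.73) with the same
conditions on norms as above» — for the print's `V₁` (first order + `F_{1,k}`), `ρ = 1`, (3.37) assumed ONLY on `stBonds(b)`/`stGrads(b)`,
`d ≥ 2`: `‖(V₁(A)A′)(b)‖ ≤ (d − 1)·α₁·[12·L^{−j}·g′ + (4 + 8α₁e^{2α₁}(3 + 2α₁ + α₁²e^{2α₁}))·L^{−2j}·a′]` (×`η²`). [folklore]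
[cite: Balaban1985BackgroundPropagators, (3.73) p.405, (3.37) p.396] -/
theorem norm_V₁op_le_st_printed [Fintype ι] [Nontrivial ι] {η L α₁ a a' g g' : ℝ} {j : ℕ} (hη : 0 < η) (hL : 1 ≤ L)
    (hU : ∀ κ z, ‖(U κ z : 𝔸)‖ ≤ 1) (hU' : ∀ κ z, ‖(((U κ z)⁻¹ : 𝔸ˣ) : 𝔸)‖ ≤ 1)
    (A A' : ι → S → 𝔸) {μ : ι} {x : S}
    (hA : ∀ κ z, (κ, z) ∈ stBonds T μ x → ‖A κ z‖ ≤ a) (ha : a ≤ α₁ * (L ^ j * η)⁻¹)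
    (hA' : ∀ κ z, (κ, z) ∈ stBonds T μ x → ‖A' κ z‖ ≤ a')
    (hdA : ∀ κ τ z, (κ, τ, z) ∈ stGrads T μ x → ‖covD T U κ (A τ) z‖ ≤ g) (hg : g ≤ η * (α₁ * ((L ^ j * η)⁻¹) ^ 2))
    (hdA' : ∀ κ τ z, (κ, τ, z) ∈ stGrads T μ x → ‖covD T U κ (A' τ) z‖ ≤ g') :
    ‖V₁op T U η A A' μ x‖
      ≤ (Fintype.card ι - 1) * (α₁ * (12 * (L ^ j)⁻¹ * g'
          + (4 + 8 * α₁ * Real.exp (2 * α₁) * (3 + 2 * α₁ + α₁ ^ 2 * Real.exp (2 * α₁))) * ((L ^ j)⁻¹) ^ 2 * a')) := by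
  unfold V₁op
  have h1 := norm_sum_sBracket_le_st_printed T U hη hL hU hU' A A' hA ha hA' hdA hg hdA'
  have h2 := norm_F₁op_le_st_printed T U hη hL hU hU' A A' hA ha hA'
  exact (norm_add_le_of_le h1 h2).trans (le_of_eq (by ring))

end Bounds

/-! ## §5  Sanity -/

section Sanity

variable {𝔸 : Type*} [NormedRing 𝔸] [NormedAlgebra ℂ 𝔸] [CompleteSpace 𝔸] {S : Type*} {ι : Type*}
variable (T : ι → Equiv.Perm S) (U : ι → S → 𝔸ˣ)

/-- A field vanishing on `st(b)` contributes nothing: `F₁(A)A′ = F₁(0)A′ = 0` at `b`. -/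
example [Fintype ι] (η : ℝ) (A A' : ι → S → 𝔸) (μ : ι) (x : S) (h0 : ∀ κ z, (κ, z) ∈ stBonds T μ x → A κ z = 0) :
    F₁op T U η A A' μ x = 0 := by
  rw [F₁op_congr_st T U η (B := 0) (B' := A') (fun κ z h => by simpa using h0 κ z h) (fun _ _ _ => rfl)]
  simp [F₁op, fRem, curlE₁, curlE₂, conjRem, covDstar]

/-- In one dimension (`ι = Unit`) there is no plaquette through `b`: `stBonds = ∅` and `V₁(A)A′ = 0`. -/
example (T : Unit → Equiv.Perm S) (U : Unit → S → 𝔸ˣ) (η : ℝ) (A A' : Unit → S → 𝔸) (x : S) :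
    stBonds T () x = ∅ ∧ V₁op T U η A A' () x = 0 := by
  refine ⟨?_, ?_⟩
  · ext q; simp [stBonds]
  · rw [V₁op, Fintype.sum_unique, F₁op, Fintype.sum_unique]
    simp [sBracket_self, fRem_self]

end Sanity

end Literature.MathematicalPhysics.QuantumFieldTheory.Balaban1983to89.B9Eq372Locality
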